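import Summits.QuantumFields.BalabanUV.Beta.EriceRemainderEnclosureHistoryAutonomyOrderLag
import Summits.QuantumFields.BalabanUV.Beta.EriceRemainderEnclosureHistoryAutonomyOrderScreening

/-!
# EriceRemainderEnclosureHistoryAutonomyOrderOffset — (E48g) THE ASYMPTOTIC OFFSET OF TWO TRAJECTORIES EXISTS IN EVERY UNIQUENESS REGIME: for a functional with a
# zeroth moment `M` of ANY size and a floor `b > 0` on ]0,γ], in any uniqueness regime, two box solutions `h, h′` from pins `t < t′` have a CONVERGENT recursion-variable
# offset `δ_j = 1∕h_j² − 1∕h′_j² → δ_∞` with the rate `|δ_n − δ_∞| ≤ M·N·U∕(b√b·√n)` (`N` the scale lag of (E48f), `U = B(γ,…) + M·γ`), `(N−1)·b ≤ δ_∞ ≤ N·U`, and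
# `1∕t² − 1∕t′² ≤ e^{3M∕(2b√b)}·δ_∞` (non-merging), so `δ_∞ > 0`: to leading order two continuum trajectories of one well-posed flow differ in the ultraviolet by a
# DEFINITE POSITIVE CONSTANT SHIFT of `1∕g²` — the relative Λ-parameter of the pair — a COCYCLE, NON-DECREASING in the larger pin; (E44a) had this for two solutions
# from ONE pin above the threshold by three bootstrap rounds, here order ((E48a)) and the lag ((E48f)) give it for two pins in one pass

Cell `pub-balaban`, β-function sub-cell, BINDER row D4 «RemainderConst leaves for Bałaban's split» (`HOME/BINDER-OWNERS.md`; owner lineage `b2b-balaban-beta-an4`;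
this file by co-owner #2 lineage `b2b-balaban-beta-d4-p2`, generation 45), β-FLOW TEAM duty (1), FREEZE (0) honoured (def-free; the limit is `limUnder atTop`, never a
`def`; node U2's `MemFlow` ∕ `SeqBox` ∕ `Sharpness.abs_sub_le_half_cube_mul`, (E43a)'s `inv_sqrt_cube_le`, (E43b)'s `sum_Ico_inv_mul_sqrt_le'` ∕ `prod_le_exp` ∕
`prod_Ico_le_prod_Ico_of_one_le`, (E48a)'s `le_of_pin_le`, (E48c)'s `le_envelope_of_pin_le`, (E48f)'s `exists_lag` ∕ `disc_le_of_lag` ∕ `le_disc_of_lag` BY NAME).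
Sequel of (E48f) `…HistoryAutonomyOrderLag` and (E48c) `…HistoryAutonomyOrderScreening` (both imported).

HONEST FRAMING (page 1, verbatim and binding).  *"Discharging BetaPertH makes Bałaban's UV stability UNCONDITIONAL — a real constructive-QFT result; it is
NOT the continuum limit and NOT the Clay problem."*  THIS FILE DISCHARGES NOTHING OF THE KIND.  Pure real analysis about an ABSTRACT functional with displayed
zeroth moment and floor in a displayed uniqueness regime; nothing of Bałaban's (1.22) asserted (GAPS G-t4-U2-1∕-2).  Row D4 class UNCHANGED (critical-path
width 0; instance 0∕1; D4 DISCHARGE NO DATE).  HONEST DEPENDENCY: continuum YM on T⁴ ⇐ BetaPertH ∧ nine spine estimates (0/9 proved); BetaPertH ⇐ (D1) ∧ (D4) ∧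
CAP+tail; G-an2-4 gates asym, D1 and NE2/3/4.

THE POINT (census sense (α); the AUTONOMY row — the Λ-parameter of a pair of trajectories).  (E48f): in a uniqueness regime the offset `δ_j` of two ordered
trajectories is bounded UNIFORMLY in the scale, `0 ≤ δ_j ≤ D = N·U`.  Then everything is summable: the increment `δ_{m+1} − δ_m = B(h(m+1+·)) − B(h′(m+1+·))` is at
most `M` times the distance of the tails, which sit under the envelope `c_i = (1∕t′² + i·b)^{−1∕2}` of the larger pin and are `≤ c_{m+1}³∕2·D` apart (half-cube
sensitivity), and `Σ_{l≥n} c_{l+1}³∕2 ≤ 1∕(b√b·√n)` (§1) — so `δ` is CAUCHY with the rate `M·D∕(b√b·√n)` and converges (§2 `tendsto_disc`, `abs_disc_sub_lim_le`); the lag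
bounds pass to the limit (§2 `lim_bounds_of_lag`).  NON-MERGING (§3): a tail bound `δ_i ≤ η` (`i ≥ n`) transports DOWN to `δ_j ≤ η·Π(1 + M∕2·c_{l+1}³) ≤ e^{3M∕(2b√b)}·η`
at every `j` ((E43b)'s downward induction for two pins; no absolute values thanks to order), whence with `η = δ_∞ + rate`: `1∕t² − 1∕t′² = δ_0 ≤ e^{3M∕(2b√b)}·δ_∞` —
the asymptotic offset is STRICTLY POSITIVE and controls the infrared difference (§3 **`disc_zero_le_exp_mul_lim`**, **`lim_pos`**; packaged on the closed threshold as
**`exists_offset_zs_closed`**).  §4: the offset is a COCYCLE in the pins and NON-DECREASING in the larger pin (order).  Census: every pair of continuum trajectories of a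
well-posed flow carries ONE positive real invariant `δ_∞`, squeezed by the integer lag, never zero for distinct pins.  NOT claimed: CONTINUITY of `δ_∞` in the pins for
general memory (isotone: squeezed in `[e^{−3M∕(2b√b)}δ_0, δ_0]` by (E48c), hence continuous at coincidence; general: open here); anything printed.

WHAT IS PROVED ([folklore]; 0 `def`, 0 sorry).  §1 `disc_succ_sub_eq`, `abs_disc_succ_sub_le_of_tail`, `sum_cube_tail_le`, **`abs_disc_sub_disc_le_of_bound`** (Cauchy tail
`M·D∕(b√b·√n)`).  §2 `disc_nonneg`, **`tendsto_disc_of_bound`**, **`abs_disc_sub_lim_le_of_bound`**, **`tendsto_disc`**, **`lim_bounds_of_lag`**.  §3 `disc_le_mul_prod_of_tail`,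
**`disc_zero_le_exp_mul_lim`**, **`lim_pos`**, **`exists_offset_zs_closed`**.  §4 `lim_cocycle`, **`lim_mono_right`**.
-/

noncomputable section
open Filter Topology Finset Set

namespace Summit.QuantumFields.BalabanUV.Beta.EriceRemainderEnclosureHistoryAutonomyOrderOffset

open Literature.MathematicalPhysics.QuantumFieldTheory.Balaban1983to89
open Literature.MathematicalPhysics.QuantumFieldTheory.Balaban1983to89.T4BetaStationary
open Literature.MathematicalPhysics.QuantumFieldTheory.Balaban1983to89.T4BetaFlowWellPosed
open Literature.MathematicalPhysics.QuantumFieldTheory.Balaban1983to89.T4BetaFlowWellPosed.Sharpness (abs_sub_le_half_cube_mul)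
open Summit.QuantumFields.BalabanUV.Beta.EriceRemainderEnclosureHistoryAutonomyThreshold (memFlow_unique_zs_closed)
open Summit.QuantumFields.BalabanUV.Beta.EriceRemainderEnclosureHistoryAutonomyDiscrepancy (inv_sqrt_cube_le)
open Summit.QuantumFields.BalabanUV.Beta.EriceRemainderEnclosureHistoryAutonomyMonotoneGeneral
  (sum_Ico_inv_mul_sqrt_le' prod_le_exp prod_Ico_le_prod_Ico_of_one_le)
open Summit.QuantumFields.BalabanUV.Beta.EriceRemainderEnclosureHistoryAutonomyOrder
open Summit.QuantumFields.BalabanUV.Beta.EriceRemainderEnclosureHistoryAutonomyOrderScreening (le_envelope_of_pin_le)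
open Summit.QuantumFields.BalabanUV.Beta.EriceRemainderEnclosureHistoryAutonomyOrderLag

variable {B : (ℕ → ℝ) → ℝ} {M γ b U D t t' : ℝ} {h h' : ℕ → ℝ}

/-! ## §1 The increments of the offset are summable once the offset is bounded: a Cauchy tail `M·D∕(b√b·√n)` -/

/-- THE INCREMENT of the offset is one memory term: `δ_{m+1} − δ_m = B(h(m+1+·)) − B(h′(m+1+·))` (two pins). [folklore] -/
theorem disc_succ_sub_eq (hf : MemFlow B t h) (hf' : MemFlow B t' h') (m : ℕ) :
    (1 / h (m + 1) ^ 2 - 1 / h' (m + 1) ^ 2) - (1 / h m ^ 2 - 1 / h' m ^ 2) =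
      B (fun j => h (m + 1 + j)) - B (fun j => h' (m + 1 + j)) := by
  rw [hf.2 m, hf'.2 m]; ring

/-- ONE INCREMENT UNDER A TAIL BOUND: if `0 ≤ δ_{m+1+i} ≤ D` for all `i` (pins `t ≤ t′`), then `|δ_{m+1} − δ_m| ≤ M·(c_{m+1}³∕2·D)`, `c_i = (1∕t′² + i·b)^{−1∕2}` — the
tails sit under the envelope of the larger pin and are `c_{m+1}³∕2·D`-close. [folklore] -/
theorem abs_disc_succ_sub_le_of_tail (hb : 0 < b)
    (hB : ∀ u u' : ℕ → ℝ, SeqBox γ u → SeqBox γ u' → ∀ D : ℝ, (∀ j, |u j - u' j| ≤ D) → |B u - B u'| ≤ M * D)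
    (hlo : ∀ u, SeqBox γ u → b ≤ B u) (ht : 0 < t) (htt' : t ≤ t') (hh : SeqBox γ h) (hh' : SeqBox γ h')
    (hf : MemFlow B t h) (hf' : MemFlow B t' h') (m : ℕ) (hδ0 : ∀ i, 0 ≤ 1 / h (m + 1 + i) ^ 2 - 1 / h' (m + 1 + i) ^ 2)
    (hδD : ∀ i, 1 / h (m + 1 + i) ^ 2 - 1 / h' (m + 1 + i) ^ 2 ≤ D) :
    |(1 / h (m + 1) ^ 2 - 1 / h' (m + 1) ^ 2) - (1 / h m ^ 2 - 1 / h' m ^ 2)|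
      ≤ M * ((1 / Real.sqrt (1 / t' ^ 2 + ((m : ℝ) + 1) * b)) ^ 3 / 2 * D) := by
  have ht' : 0 < t' := ht.trans_le htt'
  set c : ℝ := 1 / Real.sqrt (1 / t' ^ 2 + ((m : ℝ) + 1) * b) with hc
  have hP : 0 < 1 / t' ^ 2 + ((m : ℝ) + 1) * b := by
    have : (0 : ℝ) ≤ ((m : ℝ) + 1) * b := by positivity
    positivity
  have henv : ∀ {k : ℕ → ℝ} {s : ℝ}, 0 < s → s ≤ t' → SeqBox γ k → MemFlow B s k → ∀ i, k (m + 1 + i) ≤ c := by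
    intro k s hs hst' hk hfk i
    refine (le_envelope_of_pin_le hb hlo hs hst' hk hfk (m + 1 + i)).trans (one_div_sqrt_anti hP ?_)
    push_cast; nlinarith [(Nat.cast_nonneg i : (0 : ℝ) ≤ i), hb]
  have hclose : ∀ i, |h (m + 1 + i) - h' (m + 1 + i)| ≤ c ^ 3 / 2 * D := by
    intro i
    calc |h (m + 1 + i) - h' (m + 1 + i)| ≤ c ^ 3 / 2 * |1 / h (m + 1 + i) ^ 2 - 1 / h' (m + 1 + i) ^ 2| :=
          abs_sub_le_half_cube_mul (hh _).1 (hh' _).1 (henv ht htt' hh hf i) (henv ht' le_rfl hh' hf' i)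
      _ ≤ c ^ 3 / 2 * D := by
          rw [abs_of_nonneg (hδ0 _)]
          exact mul_le_mul_of_nonneg_left (hδD _) (by positivity)
  rw [disc_succ_sub_eq hf hf' m]
  exact hB _ _ (seqBox_shift hh (m + 1)) (seqBox_shift hh' (m + 1)) _ hclose

/-- THE SUMMABLE WEIGHT: `Σ_{l∈[n,j)} c_{l+1}³∕2 ≤ 1∕(b√b·√n)` for `n ≥ 1` ((E43a)'s `inv_sqrt_cube_le` + (E43b)'s telescoping). [folklore] -/
theorem sum_cube_tail_le (hb : 0 < b) (t' : ℝ) {n : ℕ} (hn : 1 ≤ n) (j : ℕ) :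
    ∑ l ∈ Ico n j, (1 / Real.sqrt (1 / t' ^ 2 + ((l : ℝ) + 1) * b)) ^ 3 / 2 ≤ 1 / (b * Real.sqrt b * Real.sqrt (n : ℝ)) := by
  have hbb : 0 < b * Real.sqrt b := by positivity
  have hterm : ∀ l : ℕ, (1 / Real.sqrt (1 / t' ^ 2 + ((l : ℝ) + 1) * b)) ^ 3 / 2
      ≤ (1 / (b * Real.sqrt b)) / 2 * (1 / (((l : ℝ) + 1) * Real.sqrt ((l : ℝ) + 1))) := by
    intro l
    have := inv_sqrt_cube_le hb t' l
    rw [show 1 / (b * Real.sqrt b * (((l : ℝ) + 1) * Real.sqrt ((l : ℝ) + 1)))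
        = 1 / (b * Real.sqrt b) * (1 / (((l : ℝ) + 1) * Real.sqrt ((l : ℝ) + 1))) by rw [one_div_mul_one_div]] at this
    linarith
  calc ∑ l ∈ Ico n j, (1 / Real.sqrt (1 / t' ^ 2 + ((l : ℝ) + 1) * b)) ^ 3 / 2
      ≤ ∑ l ∈ Ico n j, (1 / (b * Real.sqrt b)) / 2 * (1 / (((l : ℝ) + 1) * Real.sqrt ((l : ℝ) + 1))) :=
        sum_le_sum fun l _ => hterm l
    _ = (1 / (b * Real.sqrt b)) / 2 * ∑ l ∈ Ico n j, 1 / (((l : ℝ) + 1) * Real.sqrt ((l : ℝ) + 1)) := by rw [mul_sum]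
    _ ≤ (1 / (b * Real.sqrt b)) / 2 * (2 / Real.sqrt (n : ℝ)) :=
        mul_le_mul_of_nonneg_left (sum_Ico_inv_mul_sqrt_le' hn j) (by positivity)
    _ = 1 / (b * Real.sqrt b * Real.sqrt (n : ℝ)) := by
        field_simp

/-- **THE CAUCHY TAIL OF THE OFFSET**: under `0 ≤ δ_i ≤ D` (all `i`), `|δ_j − δ_n| ≤ M·D∕(b√b·√n)` for `1 ≤ n ≤ j`. [folklore] -/
theorem abs_disc_sub_disc_le_of_bound (hb : 0 < b)
    (hB : ∀ u u' : ℕ → ℝ, SeqBox γ u → SeqBox γ u' → ∀ D : ℝ, (∀ j, |u j - u' j| ≤ D) → |B u - B u'| ≤ M * D)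
    (hM : 0 ≤ M) (hlo : ∀ u, SeqBox γ u → b ≤ B u) (ht : 0 < t) (htt' : t ≤ t') (hh : SeqBox γ h) (hh' : SeqBox γ h')
    (hf : MemFlow B t h) (hf' : MemFlow B t' h') (hδ0 : ∀ i, 0 ≤ 1 / h i ^ 2 - 1 / h' i ^ 2) (hδD : ∀ i, 1 / h i ^ 2 - 1 / h' i ^ 2 ≤ D)
    {n j : ℕ} (hn : 1 ≤ n) (hnj : n ≤ j) :
    |(1 / h j ^ 2 - 1 / h' j ^ 2) - (1 / h n ^ 2 - 1 / h' n ^ 2)| ≤ M * D / (b * Real.sqrt b * Real.sqrt (n : ℝ)) := by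
  have hD : 0 ≤ D := (hδ0 0).trans (hδD 0)
  set Δ : ℕ → ℝ := fun l => (1 / h (l + 1) ^ 2 - 1 / h' (l + 1) ^ 2) - (1 / h l ^ 2 - 1 / h' l ^ 2) with hΔ
  have e : (1 / h j ^ 2 - 1 / h' j ^ 2) - (1 / h n ^ 2 - 1 / h' n ^ 2) = ∑ l ∈ Ico n j, Δ l := by
    rw [sum_Ico_eq_sub _ hnj, sum_range_sub (fun l => 1 / h l ^ 2 - 1 / h' l ^ 2) j,
      sum_range_sub (fun l => 1 / h l ^ 2 - 1 / h' l ^ 2) n]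
    ring
  rw [e]
  calc |∑ l ∈ Ico n j, Δ l| ≤ ∑ l ∈ Ico n j, |Δ l| := abs_sum_le_sum_abs _ _
    _ ≤ ∑ l ∈ Ico n j, M * ((1 / Real.sqrt (1 / t' ^ 2 + ((l : ℝ) + 1) * b)) ^ 3 / 2 * D) :=
        sum_le_sum fun l _ => abs_disc_succ_sub_le_of_tail hb hB hlo ht htt' hh hh' hf hf' l (fun i => hδ0 _) (fun i => hδD _)
    _ = M * D * ∑ l ∈ Ico n j, (1 / Real.sqrt (1 / t' ^ 2 + ((l : ℝ) + 1) * b)) ^ 3 / 2 := by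
        rw [mul_sum]; exact sum_congr rfl fun l _ => by ring
    _ ≤ M * D * (1 / (b * Real.sqrt b * Real.sqrt (n : ℝ))) :=
        mul_le_mul_of_nonneg_left (sum_cube_tail_le hb t' hn j) (mul_nonneg hM hD)
    _ = M * D / (b * Real.sqrt b * Real.sqrt (n : ℝ)) := by rw [mul_one_div]

/-! ## §2 The offset converges; the lag bounds pass to the limit -/

/-- In a uniqueness regime the offset of pins `t ≤ t′` is NONNEGATIVE at every scale ((E48a) `le_of_pin_le`). [folklore] -/
theorem disc_nonneg (hb : 0 < b)
    (hB : ∀ u u' : ℕ → ℝ, SeqBox γ u → SeqBox γ u' → ∀ D : ℝ, (∀ j, |u j - u' j| ≤ D) → |B u - B u'| ≤ M * D)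
    (hM : 0 ≤ M) (hlo : ∀ u, SeqBox γ u → b ≤ B u)
    (huniq : ∀ p, 0 < p → p ≤ γ → ∀ u u' : ℕ → ℝ, SeqBox γ u → SeqBox γ u' → MemFlow B p u → MemFlow B p u' → u = u')
    (ht : 0 < t) (htt' : t ≤ t') (ht'γ : t' ≤ γ) (hh : SeqBox γ h) (hh' : SeqBox γ h') (hf : MemFlow B t h) (hf' : MemFlow B t' h')
    (i : ℕ) : 0 ≤ 1 / h i ^ 2 - 1 / h' i ^ 2 :=
  sub_nonneg.2 (one_div_le_one_div_of_le (pow_pos (hh i).1 2)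
    (pow_le_pow_left₀ (hh i).1.le (le_of_pin_le hb hB hM hlo huniq ht htt' ht'γ hh hh' hf hf' i) 2))

/-- **A BOUNDED NONNEGATIVE OFFSET CONVERGES**: `0 ≤ δ_i ≤ D` (all `i`) ⟹ `δ_j → limUnder δ` (Cauchy in complete `ℝ`). [folklore] -/
theorem tendsto_disc_of_bound (hb : 0 < b)
    (hB : ∀ u u' : ℕ → ℝ, SeqBox γ u → SeqBox γ u' → ∀ D : ℝ, (∀ j, |u j - u' j| ≤ D) → |B u - B u'| ≤ M * D)
    (hM : 0 ≤ M) (hlo : ∀ u, SeqBox γ u → b ≤ B u) (ht : 0 < t) (htt' : t ≤ t') (hh : SeqBox γ h) (hh' : SeqBox γ h')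
    (hf : MemFlow B t h) (hf' : MemFlow B t' h') (hδ0 : ∀ i, 0 ≤ 1 / h i ^ 2 - 1 / h' i ^ 2) (hδD : ∀ i, 1 / h i ^ 2 - 1 / h' i ^ 2 ≤ D) :
    Tendsto (fun j => 1 / h j ^ 2 - 1 / h' j ^ 2) atTop (𝓝 (limUnder atTop fun j => 1 / h j ^ 2 - 1 / h' j ^ 2)) := by
  have hD : 0 ≤ D := (hδ0 0).trans (hδD 0)
  have hK : 0 ≤ M * D / (b * Real.sqrt b) := by positivity
  have hcau : CauchySeq fun j => 1 / h j ^ 2 - 1 / h' j ^ 2 := by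
    refine Metric.cauchySeq_iff'.2 fun ε hε => ?_
    obtain ⟨n, hn⟩ : ∃ n : ℕ, (M * D / (b * Real.sqrt b) / ε) ^ 2 < n := exists_nat_gt _
    refine ⟨n + 1, fun j hj => ?_⟩
    rw [Real.dist_eq]
    have hn1 : (1 : ℕ) ≤ n + 1 := by omega
    refine (abs_disc_sub_disc_le_of_bound hb hB hM hlo ht htt' hh hh' hf hf' hδ0 hδD hn1 hj).trans_lt ?_
    have hsq : M * D / (b * Real.sqrt b) / ε < Real.sqrt ((n : ℝ) + 1) :=
      (Real.lt_sqrt (div_nonneg hK hε.le)).2 (by linarith)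
    have hs0 : 0 < Real.sqrt ((n : ℝ) + 1) := Real.sqrt_pos.2 (by positivity)
    have hK' : M * D / (b * Real.sqrt b) < Real.sqrt ((n : ℝ) + 1) * ε := (div_lt_iff₀ hε).1 hsq
    push_cast
    rw [← div_div, div_lt_iff₀ hs0, mul_comm ε]
    exact hK'
  exact tendsto_nhds_limUnder (cauchySeq_tendsto_of_complete hcau)

/-- **THE RATE**: `0 ≤ δ_i ≤ D` (all `i`) ⟹ `|δ_n − δ_∞| ≤ M·D∕(b√b·√n)` for `n ≥ 1`. [folklore] -/
theorem abs_disc_sub_lim_le_of_bound (hb : 0 < b)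
    (hB : ∀ u u' : ℕ → ℝ, SeqBox γ u → SeqBox γ u' → ∀ D : ℝ, (∀ j, |u j - u' j| ≤ D) → |B u - B u'| ≤ M * D)
    (hM : 0 ≤ M) (hlo : ∀ u, SeqBox γ u → b ≤ B u) (ht : 0 < t) (htt' : t ≤ t') (hh : SeqBox γ h) (hh' : SeqBox γ h')
    (hf : MemFlow B t h) (hf' : MemFlow B t' h') (hδ0 : ∀ i, 0 ≤ 1 / h i ^ 2 - 1 / h' i ^ 2) (hδD : ∀ i, 1 / h i ^ 2 - 1 / h' i ^ 2 ≤ D)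
    {n : ℕ} (hn : 1 ≤ n) :
    |(1 / h n ^ 2 - 1 / h' n ^ 2) - limUnder atTop (fun j => 1 / h j ^ 2 - 1 / h' j ^ 2)| ≤ M * D / (b * Real.sqrt b * Real.sqrt (n : ℝ)) := by
  have hlim := tendsto_disc_of_bound hb hB hM hlo ht htt' hh hh' hf hf' hδ0 hδD
  have ht2 : Tendsto (fun j => |(1 / h j ^ 2 - 1 / h' j ^ 2) - (1 / h n ^ 2 - 1 / h' n ^ 2)|) atTop
      (𝓝 |limUnder atTop (fun j => 1 / h j ^ 2 - 1 / h' j ^ 2) - (1 / h n ^ 2 - 1 / h' n ^ 2)|) :=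
    (hlim.sub tendsto_const_nhds).abs
  rw [abs_sub_comm]
  exact le_of_tendsto ht2 (eventually_atTop.2 ⟨n, fun j hj =>
    abs_disc_sub_disc_le_of_bound hb hB hM hlo ht htt' hh hh' hf hf' hδ0 hδD hn hj⟩)

/-- **THE ASYMPTOTIC OFFSET EXISTS IN EVERY UNIQUENESS REGIME** (`B ≤ U` on the box displayed): pins `t < t′` ⟹ `δ_j → δ_∞`. [folklore] -/
theorem tendsto_disc (hb : 0 < b)
    (hB : ∀ u u' : ℕ → ℝ, SeqBox γ u → SeqBox γ u' → ∀ D : ℝ, (∀ j, |u j - u' j| ≤ D) → |B u - B u'| ≤ M * D)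
    (hM : 0 ≤ M) (hlo : ∀ u, SeqBox γ u → b ≤ B u) (hU : ∀ u, SeqBox γ u → B u ≤ U)
    (huniq : ∀ p, 0 < p → p ≤ γ → ∀ u u' : ℕ → ℝ, SeqBox γ u → SeqBox γ u' → MemFlow B p u → MemFlow B p u' → u = u')
    (ht : 0 < t) (htt' : t < t') (ht'γ : t' ≤ γ) (hh : SeqBox γ h) (hh' : SeqBox γ h') (hf : MemFlow B t h) (hf' : MemFlow B t' h') :
    Tendsto (fun j => 1 / h j ^ 2 - 1 / h' j ^ 2) atTop (𝓝 (limUnder atTop fun j => 1 / h j ^ 2 - 1 / h' j ^ 2)) := by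
  obtain ⟨N, -, hN, -⟩ := exists_lag hb hlo ht htt' ht'γ hh' hf'
  exact tendsto_disc_of_bound hb hB hM hlo ht htt'.le hh hh' hf hf'
    (disc_nonneg hb hB hM hlo huniq ht htt'.le ht'γ hh hh' hf hf')
    (fun i => disc_le_of_lag hb hB hM hlo hU huniq (htt'.le.trans ht'γ) hh hh' hf hf' hN i)

/-- **THE LAG BOUNDS PASS TO THE LIMIT**: with the lag `N` (`h′ N ≤ t < h′ (N−1)`), `(N−1)·b ≤ δ_∞ ≤ N·U` and `|δ_n − δ_∞| ≤ M·N·U∕(b√b·√n)`. [folklore] -/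
theorem lim_bounds_of_lag (hb : 0 < b)
    (hB : ∀ u u' : ℕ → ℝ, SeqBox γ u → SeqBox γ u' → ∀ D : ℝ, (∀ j, |u j - u' j| ≤ D) → |B u - B u'| ≤ M * D)
    (hM : 0 ≤ M) (hlo : ∀ u, SeqBox γ u → b ≤ B u) (hU : ∀ u, SeqBox γ u → B u ≤ U)
    (huniq : ∀ p, 0 < p → p ≤ γ → ∀ u u' : ℕ → ℝ, SeqBox γ u → SeqBox γ u' → MemFlow B p u → MemFlow B p u' → u = u')
    (ht : 0 < t) (htt' : t < t') (ht'γ : t' ≤ γ) (hh : SeqBox γ h) (hh' : SeqBox γ h') (hf : MemFlow B t h) (hf' : MemFlow B t' h')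
    {N : ℕ} (hN1 : 1 ≤ N) (hN : h' N ≤ t) (hN' : t < h' (N - 1)) :
    ((N : ℝ) - 1) * b ≤ limUnder atTop (fun j => 1 / h j ^ 2 - 1 / h' j ^ 2) ∧
      limUnder atTop (fun j => 1 / h j ^ 2 - 1 / h' j ^ 2) ≤ (N : ℝ) * U ∧
      ∀ n : ℕ, 1 ≤ n → |(1 / h n ^ 2 - 1 / h' n ^ 2) - limUnder atTop (fun j => 1 / h j ^ 2 - 1 / h' j ^ 2)|
        ≤ M * ((N : ℝ) * U) / (b * Real.sqrt b * Real.sqrt (n : ℝ)) := by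
  have htγ : t ≤ γ := htt'.le.trans ht'γ
  have hδ0 := disc_nonneg hb hB hM hlo huniq ht htt'.le ht'γ hh hh' hf hf'
  have hδD : ∀ i, 1 / h i ^ 2 - 1 / h' i ^ 2 ≤ (N : ℝ) * U := fun i => disc_le_of_lag hb hB hM hlo hU huniq htγ hh hh' hf hf' hN i
  have hlim := tendsto_disc_of_bound hb hB hM hlo ht htt'.le hh hh' hf hf' hδ0 hδD
  have hbounds := fun j => disc_bounds_of_lag hb hB hM hlo hU huniq ht htγ hh hh' hf hf' hN1 hN hN' j
  exact ⟨ge_of_tendsto' hlim fun j => (hbounds j).1.le, le_of_tendsto' hlim fun j => (hbounds j).2,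
    fun n hn => abs_disc_sub_lim_le_of_bound hb hB hM hlo ht htt'.le hh hh' hf hf' hδ0 hδD hn⟩

/-! ## §3 Non-merging: the infrared difference is at most `e^{3M∕(2b√b)}` times the asymptotic offset — which is therefore positive -/

/-- DOWNWARD TRANSPORT OF A TAIL BOUND (two pins, ordered): if `0 ≤ δ_i` everywhere and `δ_i ≤ η` for all `i ≥ n`, then at EVERY scale
`δ_j ≤ η·Π_{l∈[j,n)} (1 + M∕2·c_{l+1}³)`, `c_i = (1∕t′² + i·b)^{−1∕2}` ((E43b)'s downward induction). [folklore] -/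
theorem disc_le_mul_prod_of_tail (hb : 0 < b)
    (hB : ∀ u u' : ℕ → ℝ, SeqBox γ u → SeqBox γ u' → ∀ D : ℝ, (∀ j, |u j - u' j| ≤ D) → |B u - B u'| ≤ M * D)
    (hM : 0 ≤ M) (hlo : ∀ u, SeqBox γ u → b ≤ B u) (ht : 0 < t) (htt' : t ≤ t') (hh : SeqBox γ h) (hh' : SeqBox γ h')
    (hf : MemFlow B t h) (hf' : MemFlow B t' h') (hδ0 : ∀ i, 0 ≤ 1 / h i ^ 2 - 1 / h' i ^ 2) {n : ℕ} {η : ℝ} (hη0 : 0 ≤ η)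
    (htail : ∀ i, n ≤ i → 1 / h i ^ 2 - 1 / h' i ^ 2 ≤ η) :
    ∀ j, 1 / h j ^ 2 - 1 / h' j ^ 2 ≤ η * ∏ l ∈ Ico j n, (1 + M / 2 * (1 / Real.sqrt (1 / t' ^ 2 + ((l : ℝ) + 1) * b)) ^ 3) := by
  set f : ℕ → ℝ := fun l => 1 + M / 2 * (1 / Real.sqrt (1 / t' ^ 2 + ((l : ℝ) + 1) * b)) ^ 3 with hfdef
  have hf1 : ∀ l, 1 ≤ f l := fun l => by
    have : 0 ≤ M / 2 * (1 / Real.sqrt (1 / t' ^ 2 + ((l : ℝ) + 1) * b)) ^ 3 := by positivity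
    simp only [hfdef]; linarith
  have key : ∀ k : ℕ, ∀ j, n - k ≤ j → 1 / h j ^ 2 - 1 / h' j ^ 2 ≤ η * ∏ l ∈ Ico j n, f l := by
    intro k
    induction k with
    | zero =>
      intro j hj
      rw [Nat.sub_zero] at hj
      rw [Finset.Ico_eq_empty_of_le hj, Finset.prod_empty, mul_one]
      exact htail j hj
    | succ k ih =>
      intro j hj
      by_cases hj' : n - k ≤ j
      · exact ih j hj'
      · have hjn : j < n := by omega
        set P := ∏ l ∈ Ico (j + 1) n, f l with hP
        have hPge : ∀ i, j + 1 ≤ i → ∏ l ∈ Ico i n, f l ≤ P := fun i hi => prod_Ico_le_prod_Ico_of_one_le hf1 hi n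
        have hP0 : 0 ≤ P := prod_nonneg fun l _ => (zero_le_one.trans (hf1 l))
        have habove : ∀ i, j + 1 ≤ i → 1 / h i ^ 2 - 1 / h' i ^ 2 ≤ η * P := fun i hi =>
          (ih i (by omega)).trans (mul_le_mul_of_nonneg_left (hPge i hi) hη0)
        have hstep := abs_disc_succ_sub_le_of_tail hb hB hlo ht htt' hh hh' hf hf' j (fun i => hδ0 _)
          (fun i => habove (j + 1 + i) (by omega))
        have hDj1 := habove (j + 1) le_rfl
        rw [prod_eq_prod_Ico_succ_bot hjn]
        have e : η * (f j * P) = η * P + M * ((1 / Real.sqrt (1 / t' ^ 2 + ((j : ℝ) + 1) * b)) ^ 3 / 2 * (η * P)) := by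
          simp only [hfdef]; ring
        rw [e]
        linarith [(abs_sub_le_iff.1 hstep).2]
  intro j
  exact key n j (by omega)

/-- **NON-MERGING ACROSS TWO PINS**: in a uniqueness regime, `1∕t² − 1∕t′² ≤ e^{3M∕(2b√b)}·δ_∞` — the tail bound `δ_i ≤ δ_∞ + M·N·U∕(b√b·√n)` transported down to
scale `0` for every `n`, then `n → ∞`. [folklore] -/
theorem disc_zero_le_exp_mul_lim (hb : 0 < b)
    (hB : ∀ u u' : ℕ → ℝ, SeqBox γ u → SeqBox γ u' → ∀ D : ℝ, (∀ j, |u j - u' j| ≤ D) → |B u - B u'| ≤ M * D)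
    (hM : 0 ≤ M) (hlo : ∀ u, SeqBox γ u → b ≤ B u) (hU : ∀ u, SeqBox γ u → B u ≤ U)
    (huniq : ∀ p, 0 < p → p ≤ γ → ∀ u u' : ℕ → ℝ, SeqBox γ u → SeqBox γ u' → MemFlow B p u → MemFlow B p u' → u = u')
    (ht : 0 < t) (htt' : t < t') (ht'γ : t' ≤ γ) (hh : SeqBox γ h) (hh' : SeqBox γ h') (hf : MemFlow B t h) (hf' : MemFlow B t' h') :
    1 / t ^ 2 - 1 / t' ^ 2 ≤ Real.exp (3 * M / (2 * (b * Real.sqrt b))) * limUnder atTop (fun j => 1 / h j ^ 2 - 1 / h' j ^ 2) := by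
  have htγ : t ≤ γ := htt'.le.trans ht'γ
  obtain ⟨N, hN1, hN, hN'⟩ := exists_lag hb hlo ht htt' ht'γ hh' hf'
  set L := limUnder atTop (fun j => 1 / h j ^ 2 - 1 / h' j ^ 2) with hL
  set R := M * ((N : ℝ) * U) / (b * Real.sqrt b) with hR
  have hδ0 := disc_nonneg hb hB hM hlo huniq ht htt'.le ht'γ hh hh' hf hf'
  obtain ⟨hLlo, -, hrate⟩ := lim_bounds_of_lag hb hB hM hlo hU huniq ht htt' ht'γ hh hh' hf hf' hN1 hN hN'
  have hL0 : 0 ≤ L := le_trans (mul_nonneg (by have := (Nat.one_le_cast (α := ℝ)).2 hN1; linarith) hb.le) hLlo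
  have hR0 : 0 ≤ R := by
    have : 0 ≤ (N : ℝ) * U := (hδ0 0).trans (disc_le_of_lag hb hB hM hlo hU huniq htγ hh hh' hf hf' hN 0)
    positivity
  -- for every n ≥ 1: δ_0 ≤ e^ρ · (L + R/√n)
  have hn : ∀ n : ℕ, 1 ≤ n → 1 / t ^ 2 - 1 / t' ^ 2 ≤ Real.exp (3 * M / (2 * (b * Real.sqrt b))) * (L + R / Real.sqrt (n : ℝ)) := by
    intro n hn
    have hη0 : 0 ≤ L + R / Real.sqrt (n : ℝ) := by positivity
    have htail : ∀ i, n ≤ i → 1 / h i ^ 2 - 1 / h' i ^ 2 ≤ L + R / Real.sqrt (n : ℝ) := by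
      intro i hi
      have h1 := hrate i (hn.trans hi)
      have h2 : R / Real.sqrt (i : ℝ) ≤ R / Real.sqrt (n : ℝ) :=
        div_le_div_of_nonneg_left hR0 (Real.sqrt_pos.2 (by exact_mod_cast hn)) (Real.sqrt_le_sqrt (by exact_mod_cast hi))
      have h3 : M * ((N : ℝ) * U) / (b * Real.sqrt b * Real.sqrt (i : ℝ)) = R / Real.sqrt (i : ℝ) := by rw [hR, div_div]
      rw [h3] at h1
      linarith [(abs_sub_le_iff.1 h1).1]
    have := disc_le_mul_prod_of_tail hb hB hM hlo ht htt'.le hh hh' hf hf' hδ0 hη0 htail 0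
    rw [hf.1, hf'.1] at this
    exact this.trans (by rw [mul_comm]; exact mul_le_mul_of_nonneg_right (prod_le_exp hb hM t' 0 n) hη0)
  -- n → ∞
  have hlimR : Tendsto (fun n : ℕ => Real.exp (3 * M / (2 * (b * Real.sqrt b))) * (L + R / Real.sqrt (n : ℝ))) atTop
      (𝓝 (Real.exp (3 * M / (2 * (b * Real.sqrt b))) * (L + 0))) := by
    refine tendsto_const_nhds.mul (tendsto_const_nhds.add ?_)
    have : Tendsto (fun n : ℕ => Real.sqrt (n : ℝ)) atTop atTop :=
      Real.tendsto_sqrt_atTop.comp tendsto_natCast_atTop_atTop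
    exact tendsto_const_nhds.div_atTop this
  rw [add_zero] at hlimR
  exact ge_of_tendsto hlimR (eventually_atTop.2 ⟨1, hn⟩)

/-- **THE ASYMPTOTIC OFFSET IS STRICTLY POSITIVE**: pins `t < t′` in a uniqueness regime ⟹ `δ_∞ ≥ e^{−3M∕(2b√b)}·(1∕t² − 1∕t′²) > 0` — two distinct continuum trajectories of
one well-posed flow never merge in the `1∕g²` variable. [folklore] -/
theorem lim_pos (hb : 0 < b)
    (hB : ∀ u u' : ℕ → ℝ, SeqBox γ u → SeqBox γ u' → ∀ D : ℝ, (∀ j, |u j - u' j| ≤ D) → |B u - B u'| ≤ M * D)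
    (hM : 0 ≤ M) (hlo : ∀ u, SeqBox γ u → b ≤ B u) (hU : ∀ u, SeqBox γ u → B u ≤ U)
    (huniq : ∀ p, 0 < p → p ≤ γ → ∀ u u' : ℕ → ℝ, SeqBox γ u → SeqBox γ u' → MemFlow B p u → MemFlow B p u' → u = u')
    (ht : 0 < t) (htt' : t < t') (ht'γ : t' ≤ γ) (hh : SeqBox γ h) (hh' : SeqBox γ h') (hf : MemFlow B t h) (hf' : MemFlow B t' h') :
    Real.exp (-(3 * M / (2 * (b * Real.sqrt b)))) * (1 / t ^ 2 - 1 / t' ^ 2) ≤ limUnder atTop (fun j => 1 / h j ^ 2 - 1 / h' j ^ 2) ∧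
      0 < limUnder atTop (fun j => 1 / h j ^ 2 - 1 / h' j ^ 2) := by
  have h1 := disc_zero_le_exp_mul_lim hb hB hM hlo hU huniq ht htt' ht'γ hh hh' hf hf'
  have hD0 : 0 < 1 / t ^ 2 - 1 / t' ^ 2 :=
    sub_pos.2 (one_div_lt_one_div_of_lt (pow_pos ht 2) (pow_lt_pow_left₀ htt' ht.le two_ne_zero))
  have h2 : Real.exp (-(3 * M / (2 * (b * Real.sqrt b)))) * (1 / t ^ 2 - 1 / t' ^ 2) ≤
      limUnder atTop (fun j => 1 / h j ^ 2 - 1 / h' j ^ 2) := by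
    rw [Real.exp_neg, inv_mul_le_iff₀ (Real.exp_pos _)]
    exact h1
  exact ⟨h2, lt_of_lt_of_le (mul_pos (Real.exp_pos _) hD0) h2⟩

/-- **THE Λ-PARAMETER ON THE CLOSED THRESHOLD**: zeroth moment `M`, floor `b`, `M·γ ≤ 3√3·b`; pins `t < t′` in ]0,γ]; box solutions `h, h′`.  Then there are a limit `δ_∞`
and a lag `N ≥ 1` (`h′ N ≤ t < h′ (N−1)`) with `δ_j → δ_∞`, `|δ_n − δ_∞| ≤ M·N·U∕(b√b·√n)` (`U = B(γ,…) + M·γ`), `(N−1)·b ≤ δ_∞ ≤ N·U`, and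
`e^{−3M∕(2b√b)}·(1∕t² − 1∕t′²) ≤ δ_∞`. [folklore] -/
theorem exists_offset_zs_closed (hb : 0 < b)
    (hB : ∀ u u' : ℕ → ℝ, SeqBox γ u → SeqBox γ u' → ∀ D : ℝ, (∀ j, |u j - u' j| ≤ D) → |B u - B u'| ≤ M * D)
    (hM : 0 ≤ M) (hlo : ∀ u, SeqBox γ u → b ≤ B u) (hsmall : M * γ ≤ 3 * Real.sqrt 3 * b)
    (ht : 0 < t) (htt' : t < t') (ht'γ : t' ≤ γ) (hh : SeqBox γ h) (hh' : SeqBox γ h') (hf : MemFlow B t h) (hf' : MemFlow B t' h') :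
    ∃ (δ : ℝ) (N : ℕ), Tendsto (fun j => 1 / h j ^ 2 - 1 / h' j ^ 2) atTop (𝓝 δ) ∧ 1 ≤ N ∧ h' N ≤ t ∧ t < h' (N - 1) ∧
      (∀ n : ℕ, 1 ≤ n → |(1 / h n ^ 2 - 1 / h' n ^ 2) - δ| ≤ M * ((N : ℝ) * (B (fun _ => γ) + M * γ)) / (b * Real.sqrt b * Real.sqrt (n : ℝ))) ∧
      ((N : ℝ) - 1) * b ≤ δ ∧ δ ≤ (N : ℝ) * (B (fun _ => γ) + M * γ) ∧
      Real.exp (-(3 * M / (2 * (b * Real.sqrt b)))) * (1 / t ^ 2 - 1 / t' ^ 2) ≤ δ := by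
  have hγ : 0 < γ := ht.trans_le (htt'.le.trans ht'γ)
  have hU : ∀ u, SeqBox γ u → B u ≤ B (fun _ => γ) + M * γ := le_upper_of_zm hB hγ
  have huniq : ∀ p, 0 < p → p ≤ γ → ∀ u u' : ℕ → ℝ, SeqBox γ u → SeqBox γ u' → MemFlow B p u → MemFlow B p u' → u = u' :=
    fun _ hp0 hpγ _ _ hu hu' hfu hfu' => memFlow_unique_zs_closed hB hM hp0 hpγ hb hlo hsmall hu hu' hfu hfu'
  obtain ⟨N, hN1, hN, hN'⟩ := exists_lag hb hlo ht htt' ht'γ hh' hf'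
  obtain ⟨hlo', hhi', hrate⟩ := lim_bounds_of_lag hb hB hM hlo hU huniq ht htt' ht'γ hh hh' hf hf' hN1 hN hN'
  exact ⟨_, N, tendsto_disc hb hB hM hlo hU huniq ht htt' ht'γ hh hh' hf hf', hN1, hN, hN', hrate, hlo', hhi',
    (lim_pos hb hB hM hlo hU huniq ht htt' ht'γ hh hh' hf hf').1⟩

/-! ## §4 The offset is a cocycle in the pins and non-decreasing in the larger pin -/

/-- THE COCYCLE: for three pins `t < t′ < t″` in a uniqueness regime, `δ_∞(t,t″) = δ_∞(t,t′) + δ_∞(t′,t″)`. [folklore] -/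
theorem lim_cocycle {t'' : ℝ} {h'' : ℕ → ℝ} (hb : 0 < b)
    (hB : ∀ u u' : ℕ → ℝ, SeqBox γ u → SeqBox γ u' → ∀ D : ℝ, (∀ j, |u j - u' j| ≤ D) → |B u - B u'| ≤ M * D)
    (hM : 0 ≤ M) (hlo : ∀ u, SeqBox γ u → b ≤ B u) (hU : ∀ u, SeqBox γ u → B u ≤ U)
    (huniq : ∀ p, 0 < p → p ≤ γ → ∀ u u' : ℕ → ℝ, SeqBox γ u → SeqBox γ u' → MemFlow B p u → MemFlow B p u' → u = u')
    (ht : 0 < t) (htt' : t < t') (ht't'' : t' < t'') (ht''γ : t'' ≤ γ) (hh : SeqBox γ h) (hh' : SeqBox γ h') (hh'' : SeqBox γ h'')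
    (hf : MemFlow B t h) (hf' : MemFlow B t' h') (hf'' : MemFlow B t'' h'') :
    limUnder atTop (fun j => 1 / h j ^ 2 - 1 / h'' j ^ 2) =
      limUnder atTop (fun j => 1 / h j ^ 2 - 1 / h' j ^ 2) + limUnder atTop (fun j => 1 / h' j ^ 2 - 1 / h'' j ^ 2) := by
  have ht'γ : t' ≤ γ := ht't''.le.trans ht''γ
  have h1 := tendsto_disc hb hB hM hlo hU huniq ht htt' ht'γ hh hh' hf hf'
  have h2 := tendsto_disc hb hB hM hlo hU huniq (ht.trans htt') ht't'' ht''γ hh' hh'' hf' hf''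
  have h3 := tendsto_disc hb hB hM hlo hU huniq ht (htt'.trans ht't'') ht''γ hh hh'' hf hf''
  have h12 := h1.add h2
  have e : (fun j => 1 / h j ^ 2 - 1 / h' j ^ 2 + (1 / h' j ^ 2 - 1 / h'' j ^ 2)) = fun j => 1 / h j ^ 2 - 1 / h'' j ^ 2 :=
    funext fun j => by ring
  rw [e] at h12
  exact tendsto_nhds_unique h3 h12

/-- **THE OFFSET IS NON-DECREASING IN THE LARGER PIN**: `t < t′ < t″` ⟹ `δ_∞(t,t′) < δ_∞(t,t″)` — by the cocycle and the positivity of `δ_∞(t′,t″)`. [folklore] -/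
theorem lim_mono_right {t'' : ℝ} {h'' : ℕ → ℝ} (hb : 0 < b)
    (hB : ∀ u u' : ℕ → ℝ, SeqBox γ u → SeqBox γ u' → ∀ D : ℝ, (∀ j, |u j - u' j| ≤ D) → |B u - B u'| ≤ M * D)
    (hM : 0 ≤ M) (hlo : ∀ u, SeqBox γ u → b ≤ B u) (hU : ∀ u, SeqBox γ u → B u ≤ U)
    (huniq : ∀ p, 0 < p → p ≤ γ → ∀ u u' : ℕ → ℝ, SeqBox γ u → SeqBox γ u' → MemFlow B p u → MemFlow B p u' → u = u')
    (ht : 0 < t) (htt' : t < t') (ht't'' : t' < t'') (ht''γ : t'' ≤ γ) (hh : SeqBox γ h) (hh' : SeqBox γ h') (hh'' : SeqBox γ h'')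
    (hf : MemFlow B t h) (hf' : MemFlow B t' h') (hf'' : MemFlow B t'' h'') :
    limUnder atTop (fun j => 1 / h j ^ 2 - 1 / h' j ^ 2) < limUnder atTop (fun j => 1 / h j ^ 2 - 1 / h'' j ^ 2) := by
  rw [lim_cocycle hb hB hM hlo hU huniq ht htt' ht't'' ht''γ hh hh' hh'' hf hf' hf'']
  linarith [(lim_pos hb hB hM hlo hU huniq (ht.trans htt') ht't'' ht''γ hh' hh'' hf' hf'').2]

end Summit.QuantumFields.BalabanUV.Beta.EriceRemainderEnclosureHistoryAutonomyOrderOffset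

end
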